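import Summits.BirchSwinnertonDyer.BirchSwinnertonDyer.Theorems.ByReductionTypeAtTwoSupersingularFlatRoadLineV9
import Summits.BirchSwinnertonDyer.BirchSwinnertonDyer.Theorems.ByReductionTypeAtTwoSupersingularInputs
import HarnessLib

/-!
# A UNIFORM ♭ line for crux `SupersingularRankZeroAtTwo` (candidate `flat_uniform_two`, NOT registered):
# the crux from FIVE stubs — PUB ∧ Kato-PUB, ♭ data with Honda₂ clauses + count + CK♭ for EVERY
# good-supersingular curve at `2` (all `a₂ ∈ {0, ±2}`), the guarded μ♭ stub, Miller's lower half

Seat `bsd-2adic-ss-1` GEN 10, crux `SupersingularRankZeroAtTwo` (item stmt-BirchSwinnertonDyer-19097, route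
`ByReductionTypeAtTwo`, rung K4). The REGISTERED line is `signed_halves_two` v9 (9 stubs: the `a₂ = 0` sub-row
on Kobayashi's ± road — stubs (2) Kim's `Γ`-Euler characteristic at `2`, (3) `KobayashiLowerDivisibility W 2 1`,
(4) the ± Coleman–Kato package, (4′) μ⁺; the `a₂ = ±2` sub-row on Sprung's ♭ road — stubs (5) (5′) (6)). Since
the ♭ road's Kato half holds for EVERY good-supersingular curve at `2` (`missingUpperBoundAt_two_of_flatUpper`,
GEN 9: `c♭ = −a₂² + 2a₂ + 1` is a `2`-adic unit for all `a₂ ∈ {0, ±2}`, in particular `c♭ = 1` at `a₂ = 0`) and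
its ♭ `Γ`-Euler characteristic is now PRODUCED in the kernel for every such curve (`flatEulerChar_two`, GEN 10),
the whole crux also follows from the ♭ stubs ALONE, quantified over all `a₂`: this file proves that
composition, so the planner can weigh a 5-stub uniform line against v9 (trade: the `a₂ = 0` residues
{stub (2) = Kim EC@2 with (LAG)⁺, stub (3) MATH-BOUND as ∀, CK± (F1 R/memo (LAG)⁺, F3 P-at-2)} ↦ {COUNT♭@2,
CK♭ (F1♭ FORMAL+PRINT-at-2, F3♭ READ-AT-2), Miller's lower half certificate-shaped as on `a₂ = ±2`}). Nothing
is registered or re-registered here (no `ledger skeleton check` on this shape); v9 stays the line of record.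
* `missingUpperBoundAt_two_of_uniformFlat` — the Kato half `ord₂ #Ш ≤ ord₂ #Ш_an` on EVERY non-CM `r_an = 0`
  good-ss curve at `2` from PUB {modularity, GZK, Kato 12.4 (2), 12.4 (1) ∘ (17.13.1)} + the uniform ♭ data
  stub + the uniform guarded μ♭ stub;
* `supersingularRankZeroAtTwo_of_uniformFlatLine` — the crux BY NAME from the five stubs
  (`supersingularRankZeroAtTwo_of_halves`, GEN 0).
HONEST FRAMING: a composition certificate (kernel-checked, no sorry); the stubs are hypotheses; closes
nothing; no census cell moves; BSD is not proved by any of this.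

References: [Sprung2012] Thm. 2.2 (2′), Lemma 2.3, Prop. 7.3, Def. 7.9–7.11, Thm. 7.14, 7.16, Prop. 7.19;
[Sprung2024] §5.2 Lemmas 5.5–5.9; [Sprung2017] Cor. 4.11 (row `p = 2`); [Kato2004Asterisque] Thm. 12.4–12.5;
[KuriharaOtsuki2006] p. 564; [Miller2011LMS] Def. 1.1.
-/

set_option autoImplicit false
-- the Theorems namespace of this sub repeats the summit name by design (D-0017 nested layout)
set_option linter.dupNamespace false

noncomputable section

open scoped Classical MatrixGroups ModularForm NumberField
open NumberField IsDedekindDomain CongruenceSubgroup WeierstrassCurve Literature.NumberTheory.EllipticCurves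
  Literature.NumberTheory.EllipticCurves.ModularForms Literature.NumberTheory.EllipticCurves.Sprung2017
  Literature.NumberTheory.EllipticCurves.Sprung2012
  Literature.NumberTheory.EllipticCurves.Rank1Residual Literature.NumberTheory.EllipticCurves.Rank1Residual.Typed
  Literature.NumberTheory.EllipticCurves.Kobayashi2003 Literature.NumberTheory.EllipticCurves.IwasawaDual
  Literature.NumberTheory.GaloisRepresentations
  ZpExtension Summit.BirchSwinnertonDyer.Rank1Residual Summit.BirchSwinnertonDyer.Rank1Residual.Supersingular
  Summit.BirchSwinnertonDyer.Rank1Residual.X5.O1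

namespace Summit.BirchSwinnertonDyer.BirchSwinnertonDyer.Theorems
namespace SSFlatRoad

/-- **The Kato half at `2` on EVERY good-supersingular curve from the uniform ♭ stubs.** PUB {`hPub` =
modularity ∧ GZK; `h124`, `hX0` = Kato 12.4 (2), 12.4 (1) ∘ (17.13.1)}; `hFlatAll` = for every non-CM `r_an = 0`
curve with `GoodSS W 2` (ANY `a₂`), cyclotomic datum, place `v ∋ 2`: ∃ local data `(g, c)` with lift ∧ Honda₂
clauses ∧ COUNT♭@2 ∧ CK♭@2; `hμFlatAll` = the guarded μ♭ stub for all `a₂`. Chain per curve: the cyclotomic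
datum and the place exist (`exists_isCyclotomic_isTopGenerator_isCyclotomicVariable_holds`, `primesEquiv`);
EC♭@2 is PRODUCED (`flatEulerChar_two`); the ♭ upper divisibility by `flatUpper_two_of_flatColemanKato` (image
onto) or `…_of_mu` (else, with `hμFlatAll`); then `missingUpperBoundAt_two_of_flatUpper` (any `a₂ ∈ {0, ±2}`).
[cite: Sprung2012, Thm. 7.14 and 7.16] [cite: Sprung2024, §5.2 Lemmas 5.5–5.9] [cite: Sprung2017, Cor. 4.11]
[cite: Kato2004Asterisque, Thm. 12.4–12.5] [cite: Miller2011LMS, Def. 1.1] -/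
theorem missingUpperBoundAt_two_of_uniformFlat
    (hPub : nonempty_modularParametrizationData ∧ rank_eq_analyticRank_of_analyticRank_le_one)
    (h124 : Kato2004.thm12_4) (hX0 : Kato2004_fineSelmerDual_isTorsion)
    (hFlatAll :
      ∀ (W : WeierstrassCurve ℚ) [W.IsElliptic] [W.IsGloballyMinimal],
      ¬ W.HasCM → W.analyticRank = 0 → GoodSS W 2 →
      ∀ (κ : ZpExtension ℚ 2) (γ : Field.absoluteGaloisGroup ℚ),
        κ.IsCyclotomic → κ.IsTopGenerator γ → IsCyclotomicVariable 2 γ →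
      ∀ (v : HeightOneSpectrum (𝓞 ℚ)), (2 : 𝓞 ℚ) ∈ v.asIdeal →
      ∃ (g : Field.absoluteGaloisGroup (v.adicCompletion ℚ)) (c : ℕ → localPoints W (v.adicCompletion ℚ)),
        κ.IsTopGenerator (resGalOfEmb (closureEmb (K := ℚ) (v.adicCompletion ℚ)) g) ∧
        (∀ n, c n ∈ localLayerPointsOfEmb κ (closureEmb (K := ℚ) (v.adicCompletion ℚ)) W n) ∧
        (∀ n, 1 ≤ n → localTraceOfEmb κ (closureEmb (K := ℚ) (v.adicCompletion ℚ)) W n (n + 1)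
          (c (n + 1)) = W.frobeniusTrace 2 • c n - c (n - 1)) ∧
        (∀ z₀ : localLayerPointsOfEmb κ (closureEmb (K := ℚ) (v.adicCompletion ℚ)) W 0 →+ ℤ_[2],
          evalOn W (localLayerPointsOfEmb κ (closureEmb (K := ℚ) (v.adicCompletion ℚ)) W 0) z₀ (c 0) = 0 →
            z₀ = 0) ∧
        (∀ a : ℤ_[2],
          (∃ z₀ : localLayerPointsOfEmb κ (closureEmb (K := ℚ) (v.adicCompletion ℚ)) W 0 →+ ℤ_[2],
            evalOn W (localLayerPointsOfEmb κ (closureEmb (K := ℚ) (v.adicCompletion ℚ)) W 0) z₀ (c 0) =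
              2 * a) →
          ∃ y : localLayerPointsOfEmb κ (closureEmb (K := ℚ) (v.adicCompletion ℚ)) W 0 →+ ℤ_[2],
            evalOn W (localLayerPointsOfEmb κ (closureEmb (K := ℚ) (v.adicCompletion ℚ)) W 0) y (c 0) = a) ∧
        (Finite (W.selmerGroupPInfty 2) →
          Finite (EndCoinvariants (conjSharpFlatSelmerInfty W κ (closureEmb (K := ℚ) (v.adicCompletion ℚ))
            (W.frobeniusTrace 2) g c .flat γ - 1)) →
          Nat.card (↥((sharpFlatSelmerInfty W κ (closureEmb (K := ℚ) (v.adicCompletion ℚ))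
                (W.frobeniusTrace 2) g c .flat).comap (W.layerToInfty κ 0)) ⧸
              (W.selmerLayer κ 0).addSubgroupOf
                ((sharpFlatSelmerInfty W κ (closureEmb (K := ℚ) (v.adicCompletion ℚ))
                  (W.frobeniusTrace 2) g c .flat).comap (W.layerToInfty κ 0))) *
            Nat.card (MulAction.fixedPoints (Field.absoluteGaloisGroup ℚ) (W.geomPrimaryTorsion 2)) =
          2 ^ (padicValNat 2 W.tamagawaProduct) *
            Nat.card (EndCoinvariants (conjSharpFlatSelmerInfty W κ
              (closureEmb (K := ℚ) (v.adicCompletion ℚ)) (W.frobeniusTrace 2) g c .flat γ - 1))) ∧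
        (∀ [NeZero (W.conductorNorm ℤ)] (f : CuspForm (Gamma0 (W.conductorNorm ℤ)) 2),
            IsNewformOf W f → ∀ (ϖ : ℚ), (ϖ : ℝ) * W.realPeriodRat = plusPeriod f →
          ∀ (Ls Lf : IwasawaAlgebra 2), IsSprungPair f 2 (W.frobeniusTrace 2) Ls Lf →
          ∀ (D : SharpFlatSelmerDualData W κ γ (closureEmb (K := ℚ) (v.adicCompletion ℚ))
              (W.frobeniusTrace 2) g c .flat) [ContinuousSMul ℤ_[2] (W.tateModule 2)],
            ∃ (I : Kato2004.IwasawaH1Data W 2 κ γ) (Y : W.FineSelmerDualData κ γ)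
              (P : Submodule (IwasawaAlgebra 2) (IwasawaAlgebra 2))
              (loc : I.H →ₗ[IwasawaAlgebra 2] P) (toX : P →ₗ[IwasawaAlgebra 2] D.X)
              (δ : D.X →ₗ[IwasawaAlgebra 2] Y.X) (Z : Submodule (IwasawaAlgebra 2) I.H)
              (G : IwasawaAlgebra 2),
              Function.Exact loc toX ∧ Function.Exact toX δ ∧
              G ∈ Submodule.map (P.subtype ∘ₗ loc) Z ∧
              iwasawaToPowerSeries 2 G = PowerSeries.C (ϖ : ℚ_[2]) * iwasawaToPowerSeries 2 Lf ∧
              (∀ 𝔭 : PrimeSpectrum (IwasawaAlgebra 2), 𝔭.asIdeal.height = 1 →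
                PowerSeries.C (2 : ℤ_[2]) ∉ 𝔭.asIdeal →
                Literature.NumberTheory.EllipticCurves.Module.lengthAt (IwasawaAlgebra 2) Y.X 𝔭 ≤
                  Literature.NumberTheory.EllipticCurves.Module.lengthAt (IwasawaAlgebra 2) (I.H ⧸ Z) 𝔭) ∧
              (TwoAdicSurjective W →
                ∀ 𝔭 : PrimeSpectrum (IwasawaAlgebra 2), 𝔭.asIdeal.height = 1 →
                  PowerSeries.C (2 : ℤ_[2]) ∈ 𝔭.asIdeal →
                  Literature.NumberTheory.EllipticCurves.Module.lengthAt (IwasawaAlgebra 2) Y.X 𝔭 ≤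
                    Literature.NumberTheory.EllipticCurves.Module.lengthAt (IwasawaAlgebra 2) (I.H ⧸ Z) 𝔭)))
    (hμFlatAll :
      ∀ (W : WeierstrassCurve ℚ) [W.IsElliptic] [W.IsGloballyMinimal],
      ¬ W.HasCM → W.analyticRank = 0 → GoodSS W 2 →
      ∀ (κ : ZpExtension ℚ 2) (γ : Field.absoluteGaloisGroup ℚ),
        κ.IsCyclotomic → κ.IsTopGenerator γ → IsCyclotomicVariable 2 γ →
      ∀ (v : HeightOneSpectrum (𝓞 ℚ)), (2 : 𝓞 ℚ) ∈ v.asIdeal →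
      ∀ (g : Field.absoluteGaloisGroup (v.adicCompletion ℚ)) (c : ℕ → localPoints W (v.adicCompletion ℚ)),
        κ.IsTopGenerator (resGalOfEmb (closureEmb (K := ℚ) (v.adicCompletion ℚ)) g) →
        (∀ (D : SharpFlatSelmerDualData W κ γ (closureEmb (K := ℚ) (v.adicCompletion ℚ))
            (W.frobeniusTrace 2) g c .flat) [Module.Finite (IwasawaAlgebra 2) D.X],
          Module.IsTorsion (IwasawaAlgebra 2) D.X →
          ∀ f : IwasawaAlgebra 2, D.charIdeal = Ideal.span {f} → Finite (W.selmerGroupPInfty 2) →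
            ∃ u : ℤ_[2]ˣ, ((PowerSeries.constantCoeff f : ℤ_[2]) : ℚ_[2]) =
              ((u : ℤ_[2]) : ℚ_[2]) * ((2 : ℕ) : ℚ_[2]) ^ (padicValNat 2 W.tamagawaProduct) *
                (Nat.card (W.selmerGroupPInfty 2) : ℚ_[2])) →
        (∀ [NeZero (W.conductorNorm ℤ)] (f : CuspForm (Gamma0 (W.conductorNorm ℤ)) 2),
            IsNewformOf W f → ∀ (ϖ : ℚ), (ϖ : ℝ) * W.realPeriodRat = plusPeriod f →
          ∀ (Ls Lf : IwasawaAlgebra 2), IsSprungPair f 2 (W.frobeniusTrace 2) Ls Lf →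
          ∀ (D : SharpFlatSelmerDualData W κ γ (closureEmb (K := ℚ) (v.adicCompletion ℚ))
              (W.frobeniusTrace 2) g c .flat) [ContinuousSMul ℤ_[2] (W.tateModule 2)],
            ∃ (I : Kato2004.IwasawaH1Data W 2 κ γ) (Y : W.FineSelmerDualData κ γ)
              (P : Submodule (IwasawaAlgebra 2) (IwasawaAlgebra 2))
              (loc : I.H →ₗ[IwasawaAlgebra 2] P) (toX : P →ₗ[IwasawaAlgebra 2] D.X)
              (δ : D.X →ₗ[IwasawaAlgebra 2] Y.X) (Z : Submodule (IwasawaAlgebra 2) I.H)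
              (G : IwasawaAlgebra 2),
              Function.Exact loc toX ∧ Function.Exact toX δ ∧
              G ∈ Submodule.map (P.subtype ∘ₗ loc) Z ∧
              iwasawaToPowerSeries 2 G = PowerSeries.C (ϖ : ℚ_[2]) * iwasawaToPowerSeries 2 Lf ∧
              (∀ 𝔭 : PrimeSpectrum (IwasawaAlgebra 2), 𝔭.asIdeal.height = 1 →
                PowerSeries.C (2 : ℤ_[2]) ∉ 𝔭.asIdeal →
                Literature.NumberTheory.EllipticCurves.Module.lengthAt (IwasawaAlgebra 2) Y.X 𝔭 ≤
                  Literature.NumberTheory.EllipticCurves.Module.lengthAt (IwasawaAlgebra 2) (I.H ⧸ Z) 𝔭) ∧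
              (TwoAdicSurjective W →
                ∀ 𝔭 : PrimeSpectrum (IwasawaAlgebra 2), 𝔭.asIdeal.height = 1 →
                  PowerSeries.C (2 : ℤ_[2]) ∈ 𝔭.asIdeal →
                  Literature.NumberTheory.EllipticCurves.Module.lengthAt (IwasawaAlgebra 2) Y.X 𝔭 ≤
                    Literature.NumberTheory.EllipticCurves.Module.lengthAt (IwasawaAlgebra 2) (I.H ⧸ Z) 𝔭)) →
        ¬ TwoAdicSurjective W →
          ∀ (D : SharpFlatSelmerDualData W κ γ (closureEmb (K := ℚ) (v.adicCompletion ℚ))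
              (W.frobeniusTrace 2) g c .flat) (g' : IwasawaAlgebra 2),
            D.charIdeal = Ideal.span {g'} → ¬ PowerSeries.C (2 : ℤ_[2]) ∣ g') :
    ∀ (W : WeierstrassCurve ℚ) [W.IsElliptic] [W.IsGloballyMinimal],
      ¬ W.HasCM → W.analyticRank = 0 → GoodSS W 2 → MissingUpperBoundAt W 2 := by
  intro W _ _ hcm hr hss
  have hL : W.entireLFunction 1 ≠ 0 := entireLFunction_one_ne_zero_of_analyticRank_eq_zero W hPub.1 hr
  obtain ⟨κ, hκ, γ, hγ, hγ'⟩ := exists_isCyclotomic_isTopGenerator_isCyclotomicVariable_holds 2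
  set v : HeightOneSpectrum (𝓞 ℚ) := (Rat.HeightOneSpectrum.primesEquiv (R := 𝓞 ℚ)).symm ⟨2, Nat.prime_two⟩
    with hv_def
  have hv : (2 : 𝓞 ℚ) ∈ v.asIdeal := by
    have h := natCast_mem_asIdeal_primesEquiv_symm 2 Nat.prime_two
    simpa [hv_def] using h
  obtain ⟨g, c, hg, hc, hTr, hinj, hsat, hcount, hCK⟩ := hFlatAll W hcm hr hss κ γ hκ hγ hγ' v hv
  have hEC : ∀ (D : SharpFlatSelmerDualData W κ γ (closureEmb (K := ℚ) (v.adicCompletion ℚ))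
      (W.frobeniusTrace 2) g c .flat) [Module.Finite (IwasawaAlgebra 2) D.X],
      Module.IsTorsion (IwasawaAlgebra 2) D.X →
      ∀ f : IwasawaAlgebra 2, D.charIdeal = Ideal.span {f} → Finite (W.selmerGroupPInfty 2) →
        ∃ u : ℤ_[2]ˣ, ((PowerSeries.constantCoeff f : ℤ_[2]) : ℚ_[2]) =
          ((u : ℤ_[2]) : ℚ_[2]) * ((2 : ℕ) : ℚ_[2]) ^ (padicValNat 2 W.tamagawaProduct) *
            (Nat.card (W.selmerGroupPInfty 2) : ℚ_[2]) :=
    fun D _ hX f hf hfin ↦ flatEulerChar_two W hss κ hγ hv hg hc hTr hinj hsat hcount D hX f hf hfin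
  by_cases hsurj : TwoAdicSurjective W
  · exact missingUpperBoundAt_two_of_flatUpper W _ g c hPub.1 hPub.2 hss.1 hss.2 hL hγ hEC
      (flatUpper_two_of_flatColemanKato W _ g c h124 hX0 hss.1 hss.2 hL hκ hγ hsurj hCK)
  · exact missingUpperBoundAt_two_of_flatUpper W _ g c hPub.1 hPub.2 hss.1 hss.2 hL hγ hEC
      (flatUpper_two_of_flatColemanKato_of_mu W _ g c h124 hX0 hss.1 hss.2 hL hκ hγ hCK
        (hμFlatAll W hcm hr hss κ γ hκ hγ hγ' v hv g c hg hEC hCK hsurj))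

/-- **Crux `SupersingularRankZeroAtTwo` BY NAME from the FIVE stubs of the uniform ♭ line** (candidate
`flat_uniform_two`; NOT the registered line): `hPub` = (modularity ∧ GZK) ∧ (Kato 12.4 (2) ∧ 12.4 (1) ∘ (17.13.1));
`hFlatAll` = the uniform ♭ data stub (Honda₂ clauses ∧ COUNT♭@2 ∧ CK♭@2, all `a₂`); `hμFlatAll` = the uniform
guarded μ♭ stub; `hMLall` = Miller's lower half `ord₂ #Ш_an ≤ ord₂ #Ш` on every curve of the crux
(certificate-shaped per class, conjecture-shaped as ∀ — as v9's `stub_pmMillerLower` on `a₂ = ±2`). Via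
`supersingularRankZeroAtTwo_of_halves` (GEN 0). [cite: Miller2011LMS, Def. 1.1] [cite: Sprung2012, Thm. 7.14, 7.16]
[cite: Sprung2024, §5.2 Lemmas 5.5–5.9] [cite: Kato2004Asterisque, Thm. 12.4–12.5] -/
theorem supersingularRankZeroAtTwo_of_uniformFlatLine
    (hPub : (nonempty_modularParametrizationData ∧ rank_eq_analyticRank_of_analyticRank_le_one) ∧
      (Kato2004.thm12_4 ∧ Kato2004_fineSelmerDual_isTorsion))
    (hFlatAll :
      ∀ (W : WeierstrassCurve ℚ) [W.IsElliptic] [W.IsGloballyMinimal],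
      ¬ W.HasCM → W.analyticRank = 0 → GoodSS W 2 →
      ∀ (κ : ZpExtension ℚ 2) (γ : Field.absoluteGaloisGroup ℚ),
        κ.IsCyclotomic → κ.IsTopGenerator γ → IsCyclotomicVariable 2 γ →
      ∀ (v : HeightOneSpectrum (𝓞 ℚ)), (2 : 𝓞 ℚ) ∈ v.asIdeal →
      ∃ (g : Field.absoluteGaloisGroup (v.adicCompletion ℚ)) (c : ℕ → localPoints W (v.adicCompletion ℚ)),
        κ.IsTopGenerator (resGalOfEmb (closureEmb (K := ℚ) (v.adicCompletion ℚ)) g) ∧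
        (∀ n, c n ∈ localLayerPointsOfEmb κ (closureEmb (K := ℚ) (v.adicCompletion ℚ)) W n) ∧
        (∀ n, 1 ≤ n → localTraceOfEmb κ (closureEmb (K := ℚ) (v.adicCompletion ℚ)) W n (n + 1)
          (c (n + 1)) = W.frobeniusTrace 2 • c n - c (n - 1)) ∧
        (∀ z₀ : localLayerPointsOfEmb κ (closureEmb (K := ℚ) (v.adicCompletion ℚ)) W 0 →+ ℤ_[2],
          evalOn W (localLayerPointsOfEmb κ (closureEmb (K := ℚ) (v.adicCompletion ℚ)) W 0) z₀ (c 0) = 0 →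
            z₀ = 0) ∧
        (∀ a : ℤ_[2],
          (∃ z₀ : localLayerPointsOfEmb κ (closureEmb (K := ℚ) (v.adicCompletion ℚ)) W 0 →+ ℤ_[2],
            evalOn W (localLayerPointsOfEmb κ (closureEmb (K := ℚ) (v.adicCompletion ℚ)) W 0) z₀ (c 0) =
              2 * a) →
          ∃ y : localLayerPointsOfEmb κ (closureEmb (K := ℚ) (v.adicCompletion ℚ)) W 0 →+ ℤ_[2],
            evalOn W (localLayerPointsOfEmb κ (closureEmb (K := ℚ) (v.adicCompletion ℚ)) W 0) y (c 0) = a) ∧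
        (Finite (W.selmerGroupPInfty 2) →
          Finite (EndCoinvariants (conjSharpFlatSelmerInfty W κ (closureEmb (K := ℚ) (v.adicCompletion ℚ))
            (W.frobeniusTrace 2) g c .flat γ - 1)) →
          Nat.card (↥((sharpFlatSelmerInfty W κ (closureEmb (K := ℚ) (v.adicCompletion ℚ))
                (W.frobeniusTrace 2) g c .flat).comap (W.layerToInfty κ 0)) ⧸
              (W.selmerLayer κ 0).addSubgroupOf
                ((sharpFlatSelmerInfty W κ (closureEmb (K := ℚ) (v.adicCompletion ℚ))
                  (W.frobeniusTrace 2) g c .flat).comap (W.layerToInfty κ 0))) *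
            Nat.card (MulAction.fixedPoints (Field.absoluteGaloisGroup ℚ) (W.geomPrimaryTorsion 2)) =
          2 ^ (padicValNat 2 W.tamagawaProduct) *
            Nat.card (EndCoinvariants (conjSharpFlatSelmerInfty W κ
              (closureEmb (K := ℚ) (v.adicCompletion ℚ)) (W.frobeniusTrace 2) g c .flat γ - 1))) ∧
        (∀ [NeZero (W.conductorNorm ℤ)] (f : CuspForm (Gamma0 (W.conductorNorm ℤ)) 2),
            IsNewformOf W f → ∀ (ϖ : ℚ), (ϖ : ℝ) * W.realPeriodRat = plusPeriod f →
          ∀ (Ls Lf : IwasawaAlgebra 2), IsSprungPair f 2 (W.frobeniusTrace 2) Ls Lf →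
          ∀ (D : SharpFlatSelmerDualData W κ γ (closureEmb (K := ℚ) (v.adicCompletion ℚ))
              (W.frobeniusTrace 2) g c .flat) [ContinuousSMul ℤ_[2] (W.tateModule 2)],
            ∃ (I : Kato2004.IwasawaH1Data W 2 κ γ) (Y : W.FineSelmerDualData κ γ)
              (P : Submodule (IwasawaAlgebra 2) (IwasawaAlgebra 2))
              (loc : I.H →ₗ[IwasawaAlgebra 2] P) (toX : P →ₗ[IwasawaAlgebra 2] D.X)
              (δ : D.X →ₗ[IwasawaAlgebra 2] Y.X) (Z : Submodule (IwasawaAlgebra 2) I.H)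
              (G : IwasawaAlgebra 2),
              Function.Exact loc toX ∧ Function.Exact toX δ ∧
              G ∈ Submodule.map (P.subtype ∘ₗ loc) Z ∧
              iwasawaToPowerSeries 2 G = PowerSeries.C (ϖ : ℚ_[2]) * iwasawaToPowerSeries 2 Lf ∧
              (∀ 𝔭 : PrimeSpectrum (IwasawaAlgebra 2), 𝔭.asIdeal.height = 1 →
                PowerSeries.C (2 : ℤ_[2]) ∉ 𝔭.asIdeal →
                Literature.NumberTheory.EllipticCurves.Module.lengthAt (IwasawaAlgebra 2) Y.X 𝔭 ≤
                  Literature.NumberTheory.EllipticCurves.Module.lengthAt (IwasawaAlgebra 2) (I.H ⧸ Z) 𝔭) ∧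
              (TwoAdicSurjective W →
                ∀ 𝔭 : PrimeSpectrum (IwasawaAlgebra 2), 𝔭.asIdeal.height = 1 →
                  PowerSeries.C (2 : ℤ_[2]) ∈ 𝔭.asIdeal →
                  Literature.NumberTheory.EllipticCurves.Module.lengthAt (IwasawaAlgebra 2) Y.X 𝔭 ≤
                    Literature.NumberTheory.EllipticCurves.Module.lengthAt (IwasawaAlgebra 2) (I.H ⧸ Z) 𝔭)))
    (hμFlatAll :
      ∀ (W : WeierstrassCurve ℚ) [W.IsElliptic] [W.IsGloballyMinimal],
      ¬ W.HasCM → W.analyticRank = 0 → GoodSS W 2 →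
      ∀ (κ : ZpExtension ℚ 2) (γ : Field.absoluteGaloisGroup ℚ),
        κ.IsCyclotomic → κ.IsTopGenerator γ → IsCyclotomicVariable 2 γ →
      ∀ (v : HeightOneSpectrum (𝓞 ℚ)), (2 : 𝓞 ℚ) ∈ v.asIdeal →
      ∀ (g : Field.absoluteGaloisGroup (v.adicCompletion ℚ)) (c : ℕ → localPoints W (v.adicCompletion ℚ)),
        κ.IsTopGenerator (resGalOfEmb (closureEmb (K := ℚ) (v.adicCompletion ℚ)) g) →
        (∀ (D : SharpFlatSelmerDualData W κ γ (closureEmb (K := ℚ) (v.adicCompletion ℚ))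
            (W.frobeniusTrace 2) g c .flat) [Module.Finite (IwasawaAlgebra 2) D.X],
          Module.IsTorsion (IwasawaAlgebra 2) D.X →
          ∀ f : IwasawaAlgebra 2, D.charIdeal = Ideal.span {f} → Finite (W.selmerGroupPInfty 2) →
            ∃ u : ℤ_[2]ˣ, ((PowerSeries.constantCoeff f : ℤ_[2]) : ℚ_[2]) =
              ((u : ℤ_[2]) : ℚ_[2]) * ((2 : ℕ) : ℚ_[2]) ^ (padicValNat 2 W.tamagawaProduct) *
                (Nat.card (W.selmerGroupPInfty 2) : ℚ_[2])) →
        (∀ [NeZero (W.conductorNorm ℤ)] (f : CuspForm (Gamma0 (W.conductorNorm ℤ)) 2),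
            IsNewformOf W f → ∀ (ϖ : ℚ), (ϖ : ℝ) * W.realPeriodRat = plusPeriod f →
          ∀ (Ls Lf : IwasawaAlgebra 2), IsSprungPair f 2 (W.frobeniusTrace 2) Ls Lf →
          ∀ (D : SharpFlatSelmerDualData W κ γ (closureEmb (K := ℚ) (v.adicCompletion ℚ))
              (W.frobeniusTrace 2) g c .flat) [ContinuousSMul ℤ_[2] (W.tateModule 2)],
            ∃ (I : Kato2004.IwasawaH1Data W 2 κ γ) (Y : W.FineSelmerDualData κ γ)
              (P : Submodule (IwasawaAlgebra 2) (IwasawaAlgebra 2))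
              (loc : I.H →ₗ[IwasawaAlgebra 2] P) (toX : P →ₗ[IwasawaAlgebra 2] D.X)
              (δ : D.X →ₗ[IwasawaAlgebra 2] Y.X) (Z : Submodule (IwasawaAlgebra 2) I.H)
              (G : IwasawaAlgebra 2),
              Function.Exact loc toX ∧ Function.Exact toX δ ∧
              G ∈ Submodule.map (P.subtype ∘ₗ loc) Z ∧
              iwasawaToPowerSeries 2 G = PowerSeries.C (ϖ : ℚ_[2]) * iwasawaToPowerSeries 2 Lf ∧
              (∀ 𝔭 : PrimeSpectrum (IwasawaAlgebra 2), 𝔭.asIdeal.height = 1 →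
                PowerSeries.C (2 : ℤ_[2]) ∉ 𝔭.asIdeal →
                Literature.NumberTheory.EllipticCurves.Module.lengthAt (IwasawaAlgebra 2) Y.X 𝔭 ≤
                  Literature.NumberTheory.EllipticCurves.Module.lengthAt (IwasawaAlgebra 2) (I.H ⧸ Z) 𝔭) ∧
              (TwoAdicSurjective W →
                ∀ 𝔭 : PrimeSpectrum (IwasawaAlgebra 2), 𝔭.asIdeal.height = 1 →
                  PowerSeries.C (2 : ℤ_[2]) ∈ 𝔭.asIdeal →
                  Literature.NumberTheory.EllipticCurves.Module.lengthAt (IwasawaAlgebra 2) Y.X 𝔭 ≤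
                    Literature.NumberTheory.EllipticCurves.Module.lengthAt (IwasawaAlgebra 2) (I.H ⧸ Z) 𝔭)) →
        ¬ TwoAdicSurjective W →
          ∀ (D : SharpFlatSelmerDualData W κ γ (closureEmb (K := ℚ) (v.adicCompletion ℚ))
              (W.frobeniusTrace 2) g c .flat) (g' : IwasawaAlgebra 2),
            D.charIdeal = Ideal.span {g'} → ¬ PowerSeries.C (2 : ℤ_[2]) ∣ g')
    (hMLall : ∀ (W : WeierstrassCurve ℚ) [W.IsElliptic] [W.IsGloballyMinimal],
      ¬ W.HasCM → W.analyticRank = 0 → GoodSS W 2 → MissingLowerBoundAt W 2) :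
    Summit.BirchSwinnertonDyer.BirchSwinnertonDyer.Theses.ByReductionTypeAtTwo.SupersingularRankZeroAtTwo :=
  supersingularRankZeroAtTwo_of_halves hPub.1.2
    (missingUpperBoundAt_two_of_uniformFlat hPub.1 hPub.2.1 hPub.2.2 hFlatAll hμFlatAll) hMLall

end SSFlatRoad
end Summit.BirchSwinnertonDyer.BirchSwinnertonDyer.Theorems

end
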